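import Literature.Probability.LatticeModels.TemperleyLiebBraid
import HarnessLib

/-!
# Temperley–Lieb relations on pairings at loop weight one: the monoid identities of `connect`, the family `tlE 1`, and the braid group on link patterns

Topic `Literature/Probability/LatticeModels`; a rider on `TemperleyLiebLinkPatterns.lean` (Pearce–Rittenberg–de Gier–Nienhuis 2002: pairings
`PerfectMatching L`, the diagrammatic monoid move `connect`, the generators `tlGen δ a b` / `tlE δ j` on `PerfectMatching L →₀ R`, the first relation
`tlGen_comp_tlGen : e² = δe`, and the predicate `IsTemperleyLiebFamily`; its docstring lists «the remaining two relations for `tlE` (`eⱼ e_{j±1} eⱼ = eⱼ`, far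
commutation — finite case analyses on `connect`)» as NOT done there) and on `TemperleyLiebBraid.lean` (`kauffmanGen`, `IsTemperleyLiebFamily.braid`: the braid
relations from the Temperley–Lieb relations at loop weight one when `a² + ab + b² = 0`). THIS FILE SUPPLIES THE MISSING RELATIONS AT THE PERCOLATION POINT `δ = 1`,
where the generator is the `connect` move on basis vectors with no loop factor:

* partner bookkeeping for `connect` (`a ≠ b`): `connect_partner_partner_left/right` (the former partners of `a` and `b` become partners — also when they
  already were), `connect_partner_of_ne` (all other sites keep their partner), `connect_partner_eq` (closed form), `connect_comm` (symmetric in the sites);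
* ★ THE MONOID (BRAUER) IDENTITIES: `connect_cubic` — `((p.connect a b).connect b c).connect a b = p.connect a b` for pairwise distinct `a, b, c`;
  `connect_cubic'` (mirror); ★ `eq_connect_of` — UNIQUENESS: a pairing sending `a ↦ b` and agreeing with `p` off `{a, b, p a, p b}` is `p.connect a b`
  (the values at the former partners are forced by involutivity); ★ `connect_comm_of_disjoint` — moves at disjoint pairs of sites commute (via uniqueness);
* `tlGen_one_single'`, `tlGen_one_eq_lmapDomain` — at `δ = 1`, `tlGen 1 a b = Finsupp.lmapDomain (·.connect a b)`;
* ★★★ `isTemperleyLiebFamily_tlE_one` — **the nearest-neighbour generators `tlE 1 j` on `PerfectMatching (n+1) →₀ R` form a Temperley–Lieb family with loop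
  weight one** (ALL of (TL) at `q + q⁻¹ = 1`);
* ★★★ `tlE_one_braid` / `tlE_one_braid_comm` — hence, for `a² + ab + b² = 0` (e.g. `(a, b) = (−τ, −τ²)`, `τ = e^{2πi/3}`), the Kauffman generators
  `a·1 + b·tlE 1 j` satisfy THE BRAID RELATIONS: the Temperley–Lieb (Jones) representation of the braid group `B_{n+1}` on pairings — and on link patterns, which
  the moves preserve (`Literature/Probability/Percolation/MarkedLoopTemperleyLieb.lean`, `isNonCrossing_connect_succ`) — at the percolation point. The
  marked-loop lineage's rotation of Khristoforov–Smirnov's `k` marks is the element `g_{*,0} ∘ ρ` of this representation on the link patterns of the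
  `(k+1)`-gon (`MarkedLoopTemperleyLiebCoords.lean` / `MarkedLoopBraidRotation.lean`).

## References
* P. A. Pearce, V. Rittenberg, J. de Gier, B. Nienhuis, *Temperley–Lieb stochastic processes*, J. Phys. A 35 (2002) L661–L668, §2 (eqs. (TL), (monoid)).
* L. H. Kauffman, *Knots and Physics*, World Scientific (1991), Part I §7 (`σᵢ = A + A⁻¹Uᵢ`, Prop. 7.4 / 7.5).

## Mathlib / tree
Tree: `TemperleyLiebLinkPatterns.lean` (`PerfectMatching`, `connect`, `connect_partner`, `connect_partner_left/right`, `connect_of_partner_eq`, `connect_self`,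
`connect_connect`, `partner_inj`, `tlGen`, `tlGen_single`, `tlE`, `tlE_comp_tlE`, `IsTemperleyLiebFamily`), `TemperleyLiebBraid.lean` (`kauffmanGen`,
`IsTemperleyLiebFamily.braid`, `.braid_comm`). Mathlib: `Equiv.swap_apply_of_ne_of_ne`, `Finsupp.lmapDomain`, `Finsupp.lmapDomain_comp`, `Finsupp.lhom_ext`,
`Finsupp.mapDomain_single`.
-/

namespace Literature.Probability.LatticeModels.TemperleyLieb

open Function

variable {L : ℕ}

/-! ### Partner bookkeeping for `connect` -/

namespace PerfectMatching

variable (p : PerfectMatching L)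

/-- after connecting `a ≠ b`, the former partner of `a` is paired with the former partner of `b` (also when they already were partners).
[cite: PearceRittenbergDeGierNienhuis2002, §2 (monoid)] -/
theorem connect_partner_partner_left {a b : Fin L} (hne : a ≠ b) :
    (p.connect a b).partner (p.partner a) = p.partner b := by
  have h1 : p.partner a ≠ a := p.partner_ne a
  have h2 : p.partner a ≠ p.partner b := fun e => hne (p.partner_inj.1 e)
  rw [connect_partner, Equiv.swap_apply_of_ne_of_ne h1 h2, p.partner_partner, Equiv.swap_apply_left]

/-- after connecting `a ≠ b`, the former partner of `b` is paired with the former partner of `a`.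
[cite: PearceRittenbergDeGierNienhuis2002, §2 (monoid)] -/
theorem connect_partner_partner_right {a b : Fin L} (hne : a ≠ b) :
    (p.connect a b).partner (p.partner b) = p.partner a := by
  have h1 : p.partner a ≠ a := p.partner_ne a
  have h2 : p.partner a ≠ p.partner b := fun e => hne (p.partner_inj.1 e)
  rw [connect_partner, Equiv.swap_apply_right, Equiv.swap_apply_of_ne_of_ne h1 h2]

/-- a site other than `a`, `b` and their former partners keeps its partner. [cite: PearceRittenbergDeGierNienhuis2002, §2 (monoid)] -/
theorem connect_partner_of_ne {a b x : Fin L} (hxa : x ≠ a) (hxb : x ≠ b) (hxpa : x ≠ p.partner a) (hxpb : x ≠ p.partner b) :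
    (p.connect a b).partner x = p.partner x := by
  have h1 : p.partner x ≠ a := fun e => hxpa (by rw [← e, p.partner_partner])
  have h2 : p.partner x ≠ p.partner b := fun e => hxb (p.partner_inj.1 e)
  rw [connect_partner, Equiv.swap_apply_of_ne_of_ne hxa hxpb, Equiv.swap_apply_of_ne_of_ne h1 h2]

/-- `connect` is symmetric in the two sites. [cite: PearceRittenbergDeGierNienhuis2002, §2 (monoid)] -/
theorem connect_comm (a b : Fin L) : p.connect a b = p.connect b a := by
  by_cases hne : a = b
  · rw [hne]
  apply PerfectMatching.ext
  funext x
  by_cases hxa : x = a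
  · subst hxa; rw [p.connect_partner_left hne, p.connect_partner_right (Ne.symm hne)]
  by_cases hxb : x = b
  · subst hxb; rw [p.connect_partner_right hne, p.connect_partner_left (Ne.symm hne)]
  by_cases hxpa : x = p.partner a
  · subst hxpa; rw [p.connect_partner_partner_left hne, p.connect_partner_partner_right (Ne.symm hne)]
  by_cases hxpb : x = p.partner b
  · subst hxpb; rw [p.connect_partner_partner_right hne, p.connect_partner_partner_left (Ne.symm hne)]
  rw [p.connect_partner_of_ne hxa hxb hxpa hxpb, p.connect_partner_of_ne hxb hxa hxpb hxpa]

/-- **the partner function after a move, in closed form.** [cite: PearceRittenbergDeGierNienhuis2002, §2 (monoid)] -/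
theorem connect_partner_eq {a b : Fin L} (hne : a ≠ b) (x : Fin L) :
    (p.connect a b).partner x =
      if x = a then b else if x = b then a else if x = p.partner a then p.partner b else if x = p.partner b then p.partner a else p.partner x := by
  by_cases hxa : x = a
  · subst hxa; rw [if_pos rfl, p.connect_partner_left hne]
  rw [if_neg hxa]
  by_cases hxb : x = b
  · subst hxb; rw [if_pos rfl, p.connect_partner_right hne]
  rw [if_neg hxb]
  by_cases hxpa : x = p.partner a
  · subst hxpa; rw [if_pos rfl, p.connect_partner_partner_left hne]
  rw [if_neg hxpa]
  by_cases hxpb : x = p.partner b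
  · subst hxpb; rw [if_pos rfl, p.connect_partner_partner_right hne]
  rw [if_neg hxpb, p.connect_partner_of_ne hxa hxb hxpa hxpb]

/-! ### The monoid identities -/

/-- ★ **`e_{ab} e_{bc} e_{ab} = e_{ab}` on pairings**: `((p.connect a b).connect b c).connect a b = p.connect a b` for pairwise distinct sites.
[cite: PearceRittenbergDeGierNienhuis2002, §2 (TL), (monoid)] -/
theorem connect_cubic {a b c : Fin L} (hab : a ≠ b) (hbc : b ≠ c) (hac : a ≠ c) :
    ((p.connect a b).connect b c).connect a b = p.connect a b := by
  -- `q := p.connect a b` pairs `a` with `b`; `r := q.connect b c`; then `r.connect a b = q`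
  set q := p.connect a b with hq
  have hqa : q.partner a = b := p.connect_partner_left hab
  have hqb : q.partner b = a := p.connect_partner_right hab
  have hqbc : q.partner b ≠ c := by rw [hqb]; exact hac
  have hqca : q.partner c ≠ a := fun e => hbc (q.partner_inj.1 (by rw [hqb, e]))
  have hqcb : q.partner c ≠ b := fun e => hac (q.partner_inj.1 (by rw [hqa, e]))
  have hqcc : q.partner c ≠ c := q.partner_ne c
  set r := q.connect b c with hr
  have hrb : r.partner b = c := q.connect_partner_left hbc
  have hrc : r.partner c = b := q.connect_partner_right hbc
  have hra : r.partner a = q.partner c := by rw [← hqb]; exact q.connect_partner_partner_left hbc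
  have hrqc : r.partner (q.partner c) = a := by rw [← hqb]; exact q.connect_partner_partner_right hbc
  have hrab : r.partner a ≠ b := by rw [hra]; exact hqcb
  apply PerfectMatching.ext
  funext x
  by_cases hxa : x = a
  · subst hxa; rw [r.connect_partner_left hab, hqa]
  by_cases hxb : x = b
  · subst hxb; rw [r.connect_partner_right hab, hqb]
  by_cases hxqc : x = q.partner c
  · subst hxqc; rw [← hra, r.connect_partner_partner_left hab, hrb, hra, q.partner_partner]
  by_cases hxc : x = c
  · subst hxc; rw [← hrb, r.connect_partner_partner_right hab, hra, hrb]
  rw [r.connect_partner_of_ne hxa hxb (by rw [hra]; exact hxqc) (by rw [hrb]; exact hxc)]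
  exact q.connect_partner_of_ne hxb hxc (by rw [hqb]; exact hxa) hxqc

/-- ★ **`e_{bc} e_{ab} e_{bc} = e_{bc}` on pairings** (the mirror identity). [cite: PearceRittenbergDeGierNienhuis2002, §2 (TL), (monoid)] -/
theorem connect_cubic' {a b c : Fin L} (hab : a ≠ b) (hbc : b ≠ c) (hac : a ≠ c) :
    ((p.connect b c).connect a b).connect b c = p.connect b c := by
  have h := p.connect_cubic (a := c) (b := b) (c := a) (Ne.symm hbc) (Ne.symm hab) (Ne.symm hac)
  rw [p.connect_comm c b, (p.connect b c).connect_comm b a] at h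
  rw [((p.connect b c).connect a b).connect_comm b c]
  exact h

/-- ★ **uniqueness of the move**: a pairing sending `a` to `b` and agreeing with `p` off `{a, b, p a, p b}` IS `p.connect a b` (`a ≠ b`; the values at the two
former partners are forced by involutivity). [cite: PearceRittenbergDeGierNienhuis2002, §2 (monoid)] -/
theorem eq_connect_of {a b : Fin L} (hne : a ≠ b) {m : PerfectMatching L} (hma : m.partner a = b)
    (hoff : ∀ x, x ≠ a → x ≠ b → x ≠ p.partner a → x ≠ p.partner b → m.partner x = p.partner x) : m = p.connect a b := by
  have hmb : m.partner b = a := by rw [← hma, m.partner_partner]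
  apply PerfectMatching.ext
  funext x
  rw [p.connect_partner_eq hne]
  by_cases hxa : x = a
  · subst hxa; rw [if_pos rfl, hma]
  rw [if_neg hxa]
  by_cases hxb : x = b
  · subst hxb; rw [if_pos rfl, hmb]
  rw [if_neg hxb]
  by_cases hpab : p.partner a = b
  · have hpba : p.partner b = a := by rw [← hpab, p.partner_partner]
    rw [hpab, if_neg hxb, hpba, if_neg hxa]
    exact hoff x hxa hxb (by rw [hpab]; exact hxb) (by rw [hpba]; exact hxa)
  have hpaa : p.partner a ≠ a := p.partner_ne a
  have hpbb : p.partner b ≠ b := p.partner_ne b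
  have hpba : p.partner b ≠ a := fun e => hpab (by rw [← e, p.partner_partner])
  -- the forced values at the former partners
  have hfa : m.partner (p.partner a) = p.partner b := by
    by_contra hne'
    have hy_pa : m.partner (p.partner a) ≠ p.partner a := m.partner_ne _
    have hy_a : m.partner (p.partner a) ≠ a := fun e => by
      have h := m.partner_partner (p.partner a)
      rw [e, hma] at h
      exact hpab h.symm
    have hy_b : m.partner (p.partner a) ≠ b := fun e => by
      have h := m.partner_partner (p.partner a)
      rw [e, hmb] at h
      exact hpaa h.symm
    have h1 := hoff _ hy_a hy_b hy_pa hne'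
    rw [m.partner_partner] at h1
    exact hy_a (p.partner_inj.1 h1).symm
  have hfb : m.partner (p.partner b) = p.partner a := by
    by_contra hne'
    have hy_pb : m.partner (p.partner b) ≠ p.partner b := m.partner_ne _
    have hy_a : m.partner (p.partner b) ≠ a := fun e => by
      have h := m.partner_partner (p.partner b)
      rw [e, hma] at h
      exact hpbb h.symm
    have hy_b : m.partner (p.partner b) ≠ b := fun e => by
      have h := m.partner_partner (p.partner b)
      rw [e, hmb] at h
      exact hpba h.symm
    have h1 := hoff _ hy_a hy_b hne' hy_pb
    rw [m.partner_partner] at h1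
    exact hy_b (p.partner_inj.1 h1).symm
  by_cases hxpa : x = p.partner a
  · subst hxpa; rw [if_pos rfl, hfa]
  rw [if_neg hxpa]
  by_cases hxpb : x = p.partner b
  · subst hxpb; rw [if_pos rfl, hfb]
  rw [if_neg hxpb]
  exact hoff x hxa hxb hxpa hxpb

/-- ★ **moves at disjoint pairs of sites commute.** [cite: PearceRittenbergDeGierNienhuis2002, §2 (TL)] -/
theorem connect_comm_of_disjoint {a b c d : Fin L} (hac : a ≠ c) (had : a ≠ d) (hbc : b ≠ c) (hbd : b ≠ d) :
    (p.connect a b).connect c d = (p.connect c d).connect a b := by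
  by_cases hab : a = b
  · subst hab; rw [PerfectMatching.connect_self, PerfectMatching.connect_self]
  by_cases hcd : c = d
  · subst hcd; rw [PerfectMatching.connect_self, PerfectMatching.connect_self]
  -- `q := p.connect a b`, `q' := p.connect c d`; we show that `q.connect c d` satisfies the characterization of `q'.connect a b`
  have hqa : (p.connect a b).partner a = b := p.connect_partner_left hab
  have hqb : (p.connect a b).partner b = a := p.connect_partner_right hab
  have hq'c : (p.connect c d).partner c = d := p.connect_partner_left hcd
  have hq'd : (p.connect c d).partner d = c := p.connect_partner_right hcd
  apply (p.connect c d).eq_connect_of hab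
  · -- the value at `a`
    have h1 : a ≠ (p.connect a b).partner c := fun e => hbc ((p.connect a b).partner_inj.1 (by rw [hqb, ← e])).symm
    have h2 : a ≠ (p.connect a b).partner d := fun e => hbd ((p.connect a b).partner_inj.1 (by rw [hqb, ← e])).symm
    rw [(p.connect a b).connect_partner_of_ne hac had h1 h2, hqa]
  · intro x hxa hxb hxqa hxqb
    by_cases hxc : x = c
    · subst hxc
      rw [(p.connect a b).connect_partner_left hcd, hq'c]
    by_cases hxd : x = d
    · subst hxd
      rw [(p.connect a b).connect_partner_right hcd, hq'd]
    -- `q' a = p a` unless `a ∈ {p c, p d}`, which would force `x`-independent contradictions below; first: `x ≠ p a` and `x ≠ p b`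
    have hq'a : x = p.partner a → False := fun hx => by
      -- `a ∉ {c, d}`; if `a = p c` then `c = p a = x`, if `a = p d` then `d = x`; else `q' a = p a = x`
      have h1 : a ≠ p.partner c := fun e => hxc (by rw [hx, e, p.partner_partner])
      have h2 : a ≠ p.partner d := fun e => hxd (by rw [hx, e, p.partner_partner])
      exact hxqa (by rw [p.connect_partner_of_ne hac had h1 h2, hx])
    have hq'b : x = p.partner b → False := fun hx => by
      have h1 : b ≠ p.partner c := fun e => hxc (by rw [hx, e, p.partner_partner])
      have h2 : b ≠ p.partner d := fun e => hxd (by rw [hx, e, p.partner_partner])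
      exact hxqb (by rw [p.connect_partner_of_ne hbc hbd h1 h2, hx])
    have hxpa : x ≠ p.partner a := fun e => hq'a e
    have hxpb : x ≠ p.partner b := fun e => hq'b e
    -- `q x = p x`
    have hqx : (p.connect a b).partner x = p.partner x := p.connect_partner_of_ne hxa hxb hxpa hxpb
    -- `q c = p c` and `q d = p d` in the situations where they are compared with `x`
    by_cases hxpc : x = p.partner c
    · -- then `c ∉ {p a, p b}` (else `x ∈ {a, b}`), so `q c = p c = x`, and `d ∉ {p a, p b}` (else `x = q' a` or `q' b`), so `q d = p d`
      have hcpa : c ≠ p.partner a := fun e => hxa (by rw [hxpc, e, p.partner_partner])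
      have hcpb : c ≠ p.partner b := fun e => hxb (by rw [hxpc, e, p.partner_partner])
      have hqc : (p.connect a b).partner c = p.partner c := p.connect_partner_of_ne (Ne.symm hac) (Ne.symm hbc) hcpa hcpb
      have hdpa : d ≠ p.partner a := fun e => by
        -- `a = p d` ⇒ `q' a = p c = x`
        have hapd : a = p.partner d := by rw [e, p.partner_partner]
        have : (p.connect c d).partner a = p.partner c := by rw [hapd]; exact p.connect_partner_partner_right hcd
        exact hxqa (by rw [this, hxpc])
      have hdpb : d ≠ p.partner b := fun e => by
        have hbpd : b = p.partner d := by rw [e, p.partner_partner]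
        have : (p.connect c d).partner b = p.partner c := by rw [hbpd]; exact p.connect_partner_partner_right hcd
        exact hxqb (by rw [this, hxpc])
      have hqd : (p.connect a b).partner d = p.partner d := p.connect_partner_of_ne (Ne.symm had) (Ne.symm hbd) hdpa hdpb
      subst hxpc
      conv_lhs => rw [← hqc]
      rw [(p.connect a b).connect_partner_partner_left hcd, hqd, p.connect_partner_partner_left hcd]
    by_cases hxpd : x = p.partner d
    · have hdpa : d ≠ p.partner a := fun e => hxa (by rw [hxpd, e, p.partner_partner])
      have hdpb : d ≠ p.partner b := fun e => hxb (by rw [hxpd, e, p.partner_partner])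
      have hqd : (p.connect a b).partner d = p.partner d := p.connect_partner_of_ne (Ne.symm had) (Ne.symm hbd) hdpa hdpb
      have hcpa : c ≠ p.partner a := fun e => by
        have hapc : a = p.partner c := by rw [e, p.partner_partner]
        have : (p.connect c d).partner a = p.partner d := by rw [hapc]; exact p.connect_partner_partner_left hcd
        exact hxqa (by rw [this, hxpd])
      have hcpb : c ≠ p.partner b := fun e => by
        have hbpc : b = p.partner c := by rw [e, p.partner_partner]
        have : (p.connect c d).partner b = p.partner d := by rw [hbpc]; exact p.connect_partner_partner_left hcd
        exact hxqb (by rw [this, hxpd])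
      have hqc : (p.connect a b).partner c = p.partner c := p.connect_partner_of_ne (Ne.symm hac) (Ne.symm hbc) hcpa hcpb
      subst hxpd
      conv_lhs => rw [← hqd]
      rw [(p.connect a b).connect_partner_partner_right hcd, hqc, p.connect_partner_partner_right hcd]
    -- generic `x`: not `c, d, p c, p d`; also not `q c`, `q d`
    have hxqc : x ≠ (p.connect a b).partner c := fun e => by
      -- `q c ∈ {p b, p a, p c}`: all three excluded
      by_cases h1 : c = p.partner a
      · exact hxpb (by rw [e, h1, p.connect_partner_partner_left hab])
      by_cases h2 : c = p.partner b
      · exact hxpa (by rw [e, h2, p.connect_partner_partner_right hab])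
      · exact hxpc (by rw [e, p.connect_partner_of_ne (Ne.symm hac) (Ne.symm hbc) h1 h2])
    have hxqd : x ≠ (p.connect a b).partner d := fun e => by
      by_cases h1 : d = p.partner a
      · exact hxpb (by rw [e, h1, p.connect_partner_partner_left hab])
      by_cases h2 : d = p.partner b
      · exact hxpa (by rw [e, h2, p.connect_partner_partner_right hab])
      · exact hxpd (by rw [e, p.connect_partner_of_ne (Ne.symm had) (Ne.symm hbd) h1 h2])
    rw [(p.connect a b).connect_partner_of_ne hxc hxd hxqc hxqd, hqx, p.connect_partner_of_ne hxc hxd hxpc hxpd]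

end PerfectMatching

/-! ### The Temperley–Lieb family `tlE 1` and the braid relations on the link basis -/

section Family

variable (R : Type*) [CommRing R]

/-- at loop weight one the generator on a basis vector is the move (both branches of `tlGen_single` agree). [cite: PearceRittenbergDeGierNienhuis2002, §2 (TL), (monoid)] -/
theorem tlGen_one_single' (a b : Fin L) (p : PerfectMatching L) (c : R) :
    tlGen R (1 : R) a b (Finsupp.single p c) = Finsupp.single (p.connect a b) c := by
  rw [tlGen_single]
  split_ifs with h
  · rw [one_smul, PerfectMatching.connect_of_partner_eq p h, ← Finsupp.smul_single_one p c]
  · rw [← Finsupp.smul_single_one (p.connect a b) c]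

/-- ★ **at loop weight one the Temperley–Lieb generator is the linear map induced by the move `connect`.** [cite: PearceRittenbergDeGierNienhuis2002, §2 (TL), (monoid)] -/
theorem tlGen_one_eq_lmapDomain (a b : Fin L) :
    tlGen R (1 : R) a b = Finsupp.lmapDomain R R (fun p : PerfectMatching L => p.connect a b) := by
  refine Finsupp.lhom_ext fun p c => ?_
  rw [tlGen_one_single', Finsupp.lmapDomain_apply, Finsupp.mapDomain_single]

/-- products of induced maps are induced by composites. [folklore] -/
private theorem lmapDomain_mul' {α : Type*} (f g : α → α) :
    (Finsupp.lmapDomain R R f : Module.End R (α →₀ R)) * Finsupp.lmapDomain R R g = Finsupp.lmapDomain R R (f ∘ g) :=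
  (Finsupp.lmapDomain_comp R R g f).symm

-- TODO(general form): the cubic and far-commutation relations for `tlE δ` / `tlGen δ` at a general loop weight `δ` (loop factor when `p a = b`);
-- NOT CLAIMED here: only `δ = 1` (percolation).
/-- ★★★ **THE NEAREST-NEIGHBOUR GENERATORS `tlE 1 j` FORM A TEMPERLEY–LIEB FAMILY WITH LOOP WEIGHT ONE** on `PerfectMatching (n+1) →₀ R` (all of
Pearce–Rittenberg–de Gier–Nienhuis's relations (TL) at `q + q⁻¹ = 1`: `eⱼ² = eⱼ`, `eⱼ e_{j±1} eⱼ = eⱼ`, far commutation — the monoid identities of `connect`).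
[cite: PearceRittenbergDeGierNienhuis2002, §2 (TL), (monoid)] -/
theorem isTemperleyLiebFamily_tlE_one (n : ℕ) : IsTemperleyLiebFamily (1 : R) (fun j : Fin n => tlE (1 : R) j) := by
  refine ⟨fun j => ?_, fun j k hjk => ?_, fun j k hjk => ?_, fun i j hij => ?_⟩
  · exact tlE_comp_tlE (R := R) 1 j
  · have hk : Fin.castSucc k = j.succ := Fin.ext (by rw [Fin.val_castSucc, Fin.val_succ, hjk])
    have hab : (Fin.castSucc j : Fin (n + 1)) ≠ j.succ := (Fin.castSucc_lt_succ (i := j)).ne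
    have hbc : (j.succ : Fin (n + 1)) ≠ k.succ := fun e => by have := congrArg Fin.val e; rw [Fin.val_succ, Fin.val_succ] at this; omega
    have hac : (Fin.castSucc j : Fin (n + 1)) ≠ k.succ := fun e => by have := congrArg Fin.val e; rw [Fin.val_castSucc, Fin.val_succ] at this; omega
    show tlGen R 1 _ _ * tlGen R 1 _ _ * tlGen R 1 _ _ = tlGen R 1 _ _
    rw [tlGen_one_eq_lmapDomain, tlGen_one_eq_lmapDomain, lmapDomain_mul', lmapDomain_mul', hk]
    congr 1
    funext p
    exact p.connect_cubic hab hbc hac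
  · have hk : Fin.castSucc k = j.succ := Fin.ext (by rw [Fin.val_castSucc, Fin.val_succ, hjk])
    have hab : (Fin.castSucc j : Fin (n + 1)) ≠ j.succ := (Fin.castSucc_lt_succ (i := j)).ne
    have hbc : (j.succ : Fin (n + 1)) ≠ k.succ := fun e => by have := congrArg Fin.val e; rw [Fin.val_succ, Fin.val_succ] at this; omega
    have hac : (Fin.castSucc j : Fin (n + 1)) ≠ k.succ := fun e => by have := congrArg Fin.val e; rw [Fin.val_castSucc, Fin.val_succ] at this; omega
    show tlGen R 1 _ _ * tlGen R 1 _ _ * tlGen R 1 _ _ = tlGen R 1 _ _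
    rw [tlGen_one_eq_lmapDomain, tlGen_one_eq_lmapDomain, lmapDomain_mul', lmapDomain_mul', hk]
    congr 1
    funext p
    exact p.connect_cubic' hab hbc hac
  · have h1 : (Fin.castSucc i : Fin (n + 1)) ≠ Fin.castSucc j := fun e => by have := congrArg Fin.val e; rw [Fin.val_castSucc, Fin.val_castSucc] at this; omega
    have h2 : (Fin.castSucc i : Fin (n + 1)) ≠ j.succ := fun e => by have := congrArg Fin.val e; rw [Fin.val_castSucc, Fin.val_succ] at this; omega
    have h3 : (i.succ : Fin (n + 1)) ≠ Fin.castSucc j := fun e => by have := congrArg Fin.val e; rw [Fin.val_succ, Fin.val_castSucc] at this; omega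
    have h4 : (i.succ : Fin (n + 1)) ≠ j.succ := fun e => by have := congrArg Fin.val e; rw [Fin.val_succ, Fin.val_succ] at this; omega
    show tlGen R 1 _ _ * tlGen R 1 _ _ = tlGen R 1 _ _ * tlGen R 1 _ _
    rw [tlGen_one_eq_lmapDomain, tlGen_one_eq_lmapDomain, lmapDomain_mul', lmapDomain_mul']
    congr 1
    funext p
    exact (p.connect_comm_of_disjoint h1 h2 h3 h4).symm

/-- ★★★ **THE BRAID GROUP ON PAIRINGS / LINK PATTERNS AT THE PERCOLATION POINT**: with `a² + ab + b² = 0` (e.g. `(a, b) = (−τ, −τ²)`, `τ = e^{2πi/3}`), the Kauffman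
generators `a·1 + b·tlE 1 j` on `PerfectMatching (n+1) →₀ R` satisfy the braid relations (`TemperleyLiebBraid.IsTemperleyLiebFamily.braid`) — the Temperley–Lieb
(Jones) representation of `B_{n+1}` at loop weight one; by `Literature/Probability/Percolation/MarkedLoopTemperleyLieb.lean` the relabelling rotation of
Khristoforov–Smirnov's marks is the element `g_{*,0} ∘ ρ` of this representation on the link patterns of the `(k+1)`-gon.
[cite: Kauffman1991KnotsPhysics, Part I §7 Prop. 7.5; PearceRittenbergDeGierNienhuis2002, §2 (TL)] -/
theorem tlE_one_braid (n : ℕ) {a b : R} (hab : a ^ 2 + a * b + b ^ 2 = 0) (j k : Fin n) (hjk : k.val = j.val + 1) :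
    kauffmanGen (fun j : Fin n => tlE (1 : R) j) a b j * kauffmanGen (fun j : Fin n => tlE (1 : R) j) a b k * kauffmanGen (fun j : Fin n => tlE (1 : R) j) a b j =
      kauffmanGen (fun j : Fin n => tlE (1 : R) j) a b k * kauffmanGen (fun j : Fin n => tlE (1 : R) j) a b j *
        kauffmanGen (fun j : Fin n => tlE (1 : R) j) a b k :=
  (isTemperleyLiebFamily_tlE_one R n).braid hab j k hjk

/-- far Kauffman generators commute on pairings. [cite: Kauffman1991KnotsPhysics, Part I §7 Prop. 7.5; PearceRittenbergDeGierNienhuis2002, §2 (TL)] -/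
theorem tlE_one_braid_comm (n : ℕ) (a b : R) (i j : Fin n) (hij : j.val + 1 < i.val) :
    kauffmanGen (fun j : Fin n => tlE (1 : R) j) a b i * kauffmanGen (fun j : Fin n => tlE (1 : R) j) a b j =
      kauffmanGen (fun j : Fin n => tlE (1 : R) j) a b j * kauffmanGen (fun j : Fin n => tlE (1 : R) j) a b i :=
  (isTemperleyLiebFamily_tlE_one R n).braid_comm a b i j hij

end Family

end Literature.Probability.LatticeModels.TemperleyLieb
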